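import Summits.ValiantsHypothesis.ValiantsHypothesis.Theorems.LacunarySymmetroidMatrixDescartesCensusLP34On00010711
import Summits.ValiantsHypothesis.ValiantsHypothesis.Theorems.LacunarySymmetroidMatrixDescartesCensusLP34On00010811
import Summits.ValiantsHypothesis.ValiantsHypothesis.Theorems.LacunarySymmetroidMatrixDescartesCensusLP34On00010512
import Summits.ValiantsHypothesis.ValiantsHypothesis.Theorems.LacunarySymmetroidMatrixDescartesCensusLP34On00030712
import Summits.ValiantsHypothesis.ValiantsHypothesis.Theorems.LacunarySymmetroidMatrixDescartesCensusLP34On00010912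
import Summits.ValiantsHypothesis.ValiantsHypothesis.Theorems.LacunarySymmetroidMatrixDescartesCensusLP34On00020912
import Summits.ValiantsHypothesis.ValiantsHypothesis.Theorems.LacunarySymmetroidMatrixDescartesCensusLP34On00010413
import Summits.ValiantsHypothesis.ValiantsHypothesis.Theorems.LacunarySymmetroidMatrixDescartesCensusLP34On00030413
import Summits.ValiantsHypothesis.ValiantsHypothesis.Theorems.LacunarySymmetroidMatrixDescartesCensusLP34On00020713
import Summits.ValiantsHypothesis.ValiantsHypothesis.Theorems.LacunarySymmetroidMatrixDescartesCensusLP34On00050713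
import Summits.ValiantsHypothesis.ValiantsHypothesis.Theorems.LacunarySymmetroidMatrixDescartesCensusLP34On00010813
import Summits.ValiantsHypothesis.ValiantsHypothesis.Theorems.LacunarySymmetroidMatrixDescartesCensusLP34On00020813
import Summits.ValiantsHypothesis.ValiantsHypothesis.Theorems.LacunarySymmetroidMatrixDescartesCensusLP34On00011013
import Summits.ValiantsHypothesis.ValiantsHypothesis.Theorems.LacunarySymmetroidMatrixDescartesCensusLP34On00021013
import Summits.ValiantsHypothesis.ValiantsHypothesis.Theorems.LacunarySymmetroidMatrixDescartesCensusDoorA34Box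

/-!
# `MatrixDescartes` census — DOOR A at `(3,4)`: BOX13 IN THE KERNEL FOR PENCILS WITH A DEFINITE MIDDLE LETTER

HONEST FRAMING.  Object-search cell `pub-symmetroid`; beside the OPEN typed statement `DoorA34 = PosRootLawAt 3 4 18`
(route item `Theses.LacunarySymmetroid.DoorA34`, stmt-ValiantsHypothesis-19980), asserted nowhere.  The `(3,4)` window of width `13`
(the first residue layer of `DoorA34`, `…CensusDoorA34Box`: `BOX10` holds outright, the `28` 3-Sidon supports with `d₃ ≤ 13` are
`Census.sidon3_box13_enum`) is where engine-2's LP34 table starts.  Parts `…CensusLP34On<tag>` (typer g9) put the CHAMBER ROWS of all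
`14` representative supports in the kernel: on `12` mirror pairs every definite-letter word is dead (`doorA34_on_<d>_of_definite_letter`),
on the two RAIL pairs `(0,1,4,13) / (0,9,12,13)` and `(0,3,4,13) / (0,9,10,13)` every position but one END letter is dead
(`doorA34_on_<d>_of_definite_<l>`; LP34-CERT §6: on `(0,1,4,N)` only the word `IIID` is alive).  Uniformly over the box, the two
MIDDLE positions are always dead.  This file packages that:

* `lp34_box13_sorted` — on every sorted 3-Sidon support `0 = e₀ < e₁ < e₂ < e₃ ≤ 13`, a real symmetric pencil whose letter at
  position `1` or `2` is (positive or negative) definite has `Z₊ ≤ 18` (28-way case split over `sidon3_box13_enum`);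
* `lp34_box12_sorted`, `doorA34_box12_of_definite_letter` — the same on the window of width `12` for ANY definite letter (the six mirror pairs
  of 3-Sidon supports with `d₃ ≤ 12` have all fifteen definite words dead; no exception);
* `doorA34_box13_of_middle_definite` — **for EVERY exponent vector `d : Fin 4 → ℕ` in a window of width `13` (`d i ≤ d j + 13`) and
  every real symmetric `3 × 3` pencil `∑ X^(d l) • S l`: if some letter `S l` whose exponent lies STRICTLY BETWEEN the smallest and
  the largest exponent is positive or negative definite, then the determinant has at most `18` distinct positive roots** — repeated
  exponents and non-Sidon supports by the Descartes layer (`doorA34_on_of_not_injective`, `doorA34_on_of_card_tripleSums_le`),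
  the 3-Sidon ones by sorting (`Census.pencil_comp_equiv`), translating (`X^m` factor, `posRoots_X_pow_mul_eq`) and `lp34_box13_sorted`.

What this is NOT: the END letters of the rail supports and every all-indefinite net are untouched — nothing on `PosRootLawOn 3 4 18 d`
for any 3-Sidon `d`, on `DoorA34` (OPEN), on `ζ_sym(3,4) ∈ {18, 19}`, on `MatrixDescartes` (stmt-ValiantsHypothesis-18050) or `VP ≠ VNP`.

[folklore] Assembly of the typer's chamber rows with the box reduction of `…CensusDoorA34Box`; elementary.
-/

-- `Summit.ValiantsHypothesis.ValiantsHypothesis.…` repeats a component by the D-0017 layout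
-- (single-conjunct summit), which the `dupNamespace` linter flags; the name is mandated.
set_option linter.dupNamespace false

namespace Summit.ValiantsHypothesis.ValiantsHypothesis.Theorems.LacunarySymmetroidMatrixDescartes.Census

open Polynomial Finset
open scoped BigOperators Polynomial Matrix

set_option maxHeartbeats 4000000 in
/-- **Sorted form**: on every sorted 3-Sidon support `0 = e₀ < e₁ < e₂ < e₃ ≤ 13` (one of the `28` of `sidon3_box13_enum`), a real
symmetric `3 × 3` pencil whose letter in position `1` or `2` is positive or negative definite has at most `18` distinct positive
det-roots (the chamber rows of parts `…CensusLP34On<tag>`, case by case). [folklore] -/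
theorem lp34_box13_sorted (e : Fin 4 → ℕ) (he : StrictMono e) (he0 : e 0 = 0) (he3 : e 3 ≤ 13)
    (h20 : 20 ≤ ((Finset.univ : Finset (Fin 4 × Fin 4 × Fin 4)).image (fun p => e p.1 + e p.2.1 + e p.2.2)).card)
    (S : Fin 4 → Matrix (Fin 3) (Fin 3) ℝ) (hS : ∀ l, (S l).IsSymm) (l : Fin 4) (hl : l = 1 ∨ l = 2)
    (hdef : (S l).PosDef ∨ (-S l).PosDef) :
    ((∑ k, ((X : ℝ[X]) ^ e k) • (S k).map C).det.roots.toFinset.filter (fun t => 0 < t)).card ≤ 18 := by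
  have hv : e = (![0, e 1, e 2, e 3] : Fin 4 → ℕ) := by
    funext k; fin_cases k <;> simp [he0]
  have h1 : 0 < e 1 := by have := he (show (0 : Fin 4) < 1 by decide); omega
  have h20' : 20 ≤ ((Finset.univ : Finset (Fin 4 × Fin 4 × Fin 4)).image (fun p => (![0, e 1, e 2, e 3] : Fin 4 → ℕ) p.1 +
      (![0, e 1, e 2, e 3] : Fin 4 → ℕ) p.2.1 + (![0, e 1, e 2, e 3] : Fin 4 → ℕ) p.2.2)).card := by
    rw [← hv]; exact h20
  have hmem := sidon3_box13_enum (e 3) (List.mem_range.2 (by omega)) (e 2) (List.mem_range.2 (he (by decide)))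
    (e 1) (List.mem_range.2 (he (by decide))) h1 h20'
  rw [hv]
  simp only [List.mem_cons, List.mem_nil_iff, or_false] at hmem
  rcases hmem with h | h | h | h | h | h | h | h | h | h | h | h | h | h | h | h | h | h | h | h | h | h | h | h | h | h | h | h
  · rw [h]; exact doorA34_on_0_1_7_11_of_definite_letter S hS ⟨l, hdef⟩
  · rw [h]; exact doorA34_on_0_1_8_11_of_definite_letter S hS ⟨l, hdef⟩
  · rw [h]; exact doorA34_on_0_3_10_11_of_definite_letter S hS ⟨l, hdef⟩
  · rw [h]; exact doorA34_on_0_4_10_11_of_definite_letter S hS ⟨l, hdef⟩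
  · rw [h]; exact doorA34_on_0_1_5_12_of_definite_letter S hS ⟨l, hdef⟩
  · rw [h]; exact doorA34_on_0_3_7_12_of_definite_letter S hS ⟨l, hdef⟩
  · rw [h]; exact doorA34_on_0_1_9_12_of_definite_letter S hS ⟨l, hdef⟩
  · rw [h]; exact doorA34_on_0_2_9_12_of_definite_letter S hS ⟨l, hdef⟩
  · rw [h]; exact doorA34_on_0_5_9_12_of_definite_letter S hS ⟨l, hdef⟩
  · rw [h]; exact doorA34_on_0_3_10_12_of_definite_letter S hS ⟨l, hdef⟩
  · rw [h]; exact doorA34_on_0_3_11_12_of_definite_letter S hS ⟨l, hdef⟩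
  · rw [h]; exact doorA34_on_0_7_11_12_of_definite_letter S hS ⟨l, hdef⟩
  · rw [h]; rcases hl with rfl | rfl
    · exact doorA34_on_0_1_4_13_of_definite_1 S hS hdef
    · exact doorA34_on_0_1_4_13_of_definite_2 S hS hdef
  · rw [h]; rcases hl with rfl | rfl
    · exact doorA34_on_0_3_4_13_of_definite_1 S hS hdef
    · exact doorA34_on_0_3_4_13_of_definite_2 S hS hdef
  · rw [h]; exact doorA34_on_0_2_7_13_of_definite_letter S hS ⟨l, hdef⟩
  · rw [h]; exact doorA34_on_0_5_7_13_of_definite_letter S hS ⟨l, hdef⟩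
  · rw [h]; exact doorA34_on_0_1_8_13_of_definite_letter S hS ⟨l, hdef⟩
  · rw [h]; exact doorA34_on_0_2_8_13_of_definite_letter S hS ⟨l, hdef⟩
  · rw [h]; exact doorA34_on_0_6_8_13_of_definite_letter S hS ⟨l, hdef⟩
  · rw [h]; exact doorA34_on_0_1_10_13_of_definite_letter S hS ⟨l, hdef⟩
  · rw [h]; exact doorA34_on_0_2_10_13_of_definite_letter S hS ⟨l, hdef⟩
  · rw [h]; rcases hl with rfl | rfl
    · exact doorA34_on_0_9_10_13_of_definite_1 S hS hdef
    · exact doorA34_on_0_9_10_13_of_definite_2 S hS hdef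
  · rw [h]; exact doorA34_on_0_3_11_13_of_definite_letter S hS ⟨l, hdef⟩
  · rw [h]; exact doorA34_on_0_5_11_13_of_definite_letter S hS ⟨l, hdef⟩
  · rw [h]; exact doorA34_on_0_6_11_13_of_definite_letter S hS ⟨l, hdef⟩
  · rw [h]; exact doorA34_on_0_3_12_13_of_definite_letter S hS ⟨l, hdef⟩
  · rw [h]; exact doorA34_on_0_5_12_13_of_definite_letter S hS ⟨l, hdef⟩
  · rw [h]; rcases hl with rfl | rfl
    · exact doorA34_on_0_9_12_13_of_definite_1 S hS hdef
    · exact doorA34_on_0_9_12_13_of_definite_2 S hS hdef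

/-- **DOOR A ON THE WINDOW OF WIDTH 13 FOR PENCILS WITH A DEFINITE MIDDLE LETTER.**  Let `d : Fin 4 → ℕ` be any exponent vector
with `d i ≤ d j + 13` for all `i, j`, and `S` real symmetric `3 × 3` letters.  If some letter `S l` whose exponent lies strictly
between the smallest and the largest exponent (`∃ i j, d i < d l < d j`) is positive or negative definite, then
`det (∑ X^(d l) • S l)` has at most `18` distinct positive roots — one less than the Descartes ceiling `19 = D(3,4)`. [folklore] -/
theorem doorA34_box13_of_middle_definite (d : Fin 4 → ℕ) (hw : ∀ i j, d i ≤ d j + 13)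
    (S : Fin 4 → Matrix (Fin 3) (Fin 3) ℝ) (hS : ∀ l, (S l).IsSymm)
    (hmid : ∃ l, (∃ i, d i < d l) ∧ (∃ j, d l < d j) ∧ ((S l).PosDef ∨ (-S l).PosDef)) :
    ((∑ k, ((X : ℝ[X]) ^ d k) • (S k).map C).det.roots.toFinset.filter (fun t => 0 < t)).card ≤ 18 := by
  classical
  by_cases hinj : Function.Injective d
  · -- sort
    set σ := Tuple.sort d with hσ
    have hmono : Monotone (d ∘ σ) := Tuple.monotone_sort d
    have hsm : StrictMono (d ∘ σ) := hmono.strictMono_of_injective (hinj.comp σ.injective)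
    -- translate
    set m := (d ∘ σ) 0 with hm
    have hmle : ∀ l, m ≤ (d ∘ σ) l := fun l => hmono (Fin.zero_le l)
    set e : Fin 4 → ℕ := fun l => (d ∘ σ) l - m with hedef
    have hde : ∀ l, d (σ l) = e l + m := by
      intro l; simp only [hedef, Function.comp]; have := hmle l; simp only [Function.comp] at this; omega
    have he_mono : StrictMono e := by
      intro a b hab; simp only [hedef]; have := hsm hab; have := hmle a; omega
    have he0 : e 0 = 0 := by simp [hedef, hm]
    have he3 : e 3 ≤ 13 := by
      simp only [hedef]
      have := hw (σ 3) (σ 0)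
      simp only [hm, Function.comp] at this ⊢
      omega
    -- the pencil on `d` is the pencil on `e` (letters re-indexed by `σ`) times `X^m`
    have hpen : (∑ k, ((X : ℝ[X]) ^ d k) • (S k).map C) = (X : ℝ[X]) ^ m • ∑ k, ((X : ℝ[X]) ^ e k) • ((S ∘ σ) k).map C := by
      rw [← pencil_comp_equiv σ d S, Finset.smul_sum]
      refine Finset.sum_congr rfl fun k _ => ?_
      rw [hde, smul_smul, ← pow_add, add_comm, Function.comp_apply]
    have hcard : ((∑ k, ((X : ℝ[X]) ^ d k) • (S k).map C).det.roots.toFinset.filter (fun t => 0 < t)).card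
        = ((∑ k, ((X : ℝ[X]) ^ e k) • ((S ∘ σ) k).map C).det.roots.toFinset.filter (fun t => 0 < t)).card := by
      rw [hpen, Matrix.det_smul, Fintype.card_fin, ← pow_mul, posRoots_X_pow_mul_eq]
    rw [hcard]
    by_cases hc : ((Finset.univ : Finset (Fin 4 × Fin 4 × Fin 4)).image (fun p => e p.1 + e p.2.1 + e p.2.2)).card ≤ 19
    · exact doorA34_on_of_card_tripleSums_le e hc (S ∘ σ) (fun k => hS _)
    · obtain ⟨l, ⟨i, hi⟩, ⟨j, hj⟩, hdef⟩ := hmid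
      -- the definite letter sits at the sorted position `σ.symm l ∈ {1, 2}`
      have hil : e (σ.symm i) < e (σ.symm l) := by
        have h1 := hde (σ.symm i); have h2 := hde (σ.symm l)
        rw [Equiv.apply_symm_apply] at h1 h2; omega
      have hlj : e (σ.symm l) < e (σ.symm j) := by
        have h1 := hde (σ.symm l); have h2 := hde (σ.symm j)
        rw [Equiv.apply_symm_apply] at h1 h2; omega
      have hl12 : σ.symm l = 1 ∨ σ.symm l = 2 := by
        have hlo : e 0 ≤ e (σ.symm i) := he_mono.monotone (Fin.zero_le _)
        have hhi : e (σ.symm j) ≤ e 3 := he_mono.monotone (Fin.le_last _)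
        have hne0 : σ.symm l ≠ 0 := by intro h0; rw [h0] at hil; omega
        have hne3 : σ.symm l ≠ 3 := by intro h3; rw [h3] at hlj; omega
        revert hne0 hne3; generalize σ.symm l = x; intro hne0 hne3; fin_cases x <;> simp_all
      have hdef' : ((S ∘ σ) (σ.symm l)).PosDef ∨ (-(S ∘ σ) (σ.symm l)).PosDef := by
        simpa [Function.comp, Equiv.apply_symm_apply] using hdef
      exact lp34_box13_sorted e he_mono he0 he3 (by omega) (S ∘ σ) (fun k => hS _) (σ.symm l) hl12 hdef'
  · exact doorA34_on_of_not_injective d hinj S hS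

set_option maxHeartbeats 4000000 in
/-- **BOX12, sorted form**: on every sorted 3-Sidon support `0 = e₀ < e₁ < e₂ < e₃ ≤ 12` (six mirror pairs, all fifteen definite words
dead in engine-2's table), a real symmetric `3 × 3` pencil with ANY definite letter has at most `18` distinct positive det-roots. [folklore] -/
theorem lp34_box12_sorted (e : Fin 4 → ℕ) (he : StrictMono e) (he0 : e 0 = 0) (he3 : e 3 ≤ 12)
    (h20 : 20 ≤ ((Finset.univ : Finset (Fin 4 × Fin 4 × Fin 4)).image (fun p => e p.1 + e p.2.1 + e p.2.2)).card)
    (S : Fin 4 → Matrix (Fin 3) (Fin 3) ℝ) (hS : ∀ l, (S l).IsSymm) (hdef : ∃ l, (S l).PosDef ∨ (-S l).PosDef) :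
    ((∑ k, ((X : ℝ[X]) ^ e k) • (S k).map C).det.roots.toFinset.filter (fun t => 0 < t)).card ≤ 18 := by
  have hv : e = (![0, e 1, e 2, e 3] : Fin 4 → ℕ) := by
    funext k; fin_cases k <;> simp [he0]
  have h1 : 0 < e 1 := by have := he (show (0 : Fin 4) < 1 by decide); omega
  have h20' : 20 ≤ ((Finset.univ : Finset (Fin 4 × Fin 4 × Fin 4)).image (fun p => (![0, e 1, e 2, e 3] : Fin 4 → ℕ) p.1 +
      (![0, e 1, e 2, e 3] : Fin 4 → ℕ) p.2.1 + (![0, e 1, e 2, e 3] : Fin 4 → ℕ) p.2.2)).card := by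
    rw [← hv]; exact h20
  have hmem := sidon3_box13_enum (e 3) (List.mem_range.2 (by omega)) (e 2) (List.mem_range.2 (he (by decide)))
    (e 1) (List.mem_range.2 (he (by decide))) h1 h20'
  rw [hv]
  simp only [List.mem_cons, List.mem_nil_iff, or_false] at hmem
  rcases hmem with h | h | h | h | h | h | h | h | h | h | h | h | h | h | h | h | h | h | h | h | h | h | h | h | h | h | h | h
  · rw [h]; exact doorA34_on_0_1_7_11_of_definite_letter S hS hdef
  · rw [h]; exact doorA34_on_0_1_8_11_of_definite_letter S hS hdef
  · rw [h]; exact doorA34_on_0_3_10_11_of_definite_letter S hS hdef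
  · rw [h]; exact doorA34_on_0_4_10_11_of_definite_letter S hS hdef
  · rw [h]; exact doorA34_on_0_1_5_12_of_definite_letter S hS hdef
  · rw [h]; exact doorA34_on_0_3_7_12_of_definite_letter S hS hdef
  · rw [h]; exact doorA34_on_0_1_9_12_of_definite_letter S hS hdef
  · rw [h]; exact doorA34_on_0_2_9_12_of_definite_letter S hS hdef
  · rw [h]; exact doorA34_on_0_5_9_12_of_definite_letter S hS hdef
  · rw [h]; exact doorA34_on_0_3_10_12_of_definite_letter S hS hdef
  · rw [h]; exact doorA34_on_0_3_11_12_of_definite_letter S hS hdef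
  · rw [h]; exact doorA34_on_0_7_11_12_of_definite_letter S hS hdef
  · exfalso; have h3 := congrFun h 3; simp at h3; omega
  · exfalso; have h3 := congrFun h 3; simp at h3; omega
  · exfalso; have h3 := congrFun h 3; simp at h3; omega
  · exfalso; have h3 := congrFun h 3; simp at h3; omega
  · exfalso; have h3 := congrFun h 3; simp at h3; omega
  · exfalso; have h3 := congrFun h 3; simp at h3; omega
  · exfalso; have h3 := congrFun h 3; simp at h3; omega
  · exfalso; have h3 := congrFun h 3; simp at h3; omega
  · exfalso; have h3 := congrFun h 3; simp at h3; omega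
  · exfalso; have h3 := congrFun h 3; simp at h3; omega
  · exfalso; have h3 := congrFun h 3; simp at h3; omega
  · exfalso; have h3 := congrFun h 3; simp at h3; omega
  · exfalso; have h3 := congrFun h 3; simp at h3; omega
  · exfalso; have h3 := congrFun h 3; simp at h3; omega
  · exfalso; have h3 := congrFun h 3; simp at h3; omega
  · exfalso; have h3 := congrFun h 3; simp at h3; omega

/-- **DOOR A ON THE WINDOW OF WIDTH 12 FOR PENCILS WITH A DEFINITE LETTER.**  Let `d : Fin 4 → ℕ` be any exponent vector with
`d i ≤ d j + 12` for all `i, j`, and `S` real symmetric `3 × 3` letters one of which is positive or negative definite.  Then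
`det (∑ X^(d l) • S l)` has at most `18` distinct positive roots.  (No exception: every 3-Sidon support of width `≤ 12` has all fifteen
definite-letter words dead in engine-2's LP34 table, replayed in parts `…CensusLP34On<tag>`; the all-indefinite nets are untouched.) [folklore] -/
theorem doorA34_box12_of_definite_letter (d : Fin 4 → ℕ) (hw : ∀ i j, d i ≤ d j + 12)
    (S : Fin 4 → Matrix (Fin 3) (Fin 3) ℝ) (hS : ∀ l, (S l).IsSymm) (hdef : ∃ l, (S l).PosDef ∨ (-S l).PosDef) :
    ((∑ k, ((X : ℝ[X]) ^ d k) • (S k).map C).det.roots.toFinset.filter (fun t => 0 < t)).card ≤ 18 := by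
  classical
  by_cases hinj : Function.Injective d
  · set σ := Tuple.sort d with hσ
    have hmono : Monotone (d ∘ σ) := Tuple.monotone_sort d
    have hsm : StrictMono (d ∘ σ) := hmono.strictMono_of_injective (hinj.comp σ.injective)
    set m := (d ∘ σ) 0 with hm
    have hmle : ∀ l, m ≤ (d ∘ σ) l := fun l => hmono (Fin.zero_le l)
    set e : Fin 4 → ℕ := fun l => (d ∘ σ) l - m with hedef
    have hde : ∀ l, d (σ l) = e l + m := by
      intro l; simp only [hedef, Function.comp]; have := hmle l; simp only [Function.comp] at this; omega
    have he_mono : StrictMono e := by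
      intro a b hab; simp only [hedef]; have := hsm hab; have := hmle a; omega
    have he0 : e 0 = 0 := by simp [hedef, hm]
    have he3 : e 3 ≤ 12 := by
      simp only [hedef]
      have := hw (σ 3) (σ 0)
      simp only [hm, Function.comp] at this ⊢
      omega
    have hpen : (∑ k, ((X : ℝ[X]) ^ d k) • (S k).map C) = (X : ℝ[X]) ^ m • ∑ k, ((X : ℝ[X]) ^ e k) • ((S ∘ σ) k).map C := by
      rw [← pencil_comp_equiv σ d S, Finset.smul_sum]
      refine Finset.sum_congr rfl fun k _ => ?_
      rw [hde, smul_smul, ← pow_add, add_comm, Function.comp_apply]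
    have hcard : ((∑ k, ((X : ℝ[X]) ^ d k) • (S k).map C).det.roots.toFinset.filter (fun t => 0 < t)).card
        = ((∑ k, ((X : ℝ[X]) ^ e k) • ((S ∘ σ) k).map C).det.roots.toFinset.filter (fun t => 0 < t)).card := by
      rw [hpen, Matrix.det_smul, Fintype.card_fin, ← pow_mul, posRoots_X_pow_mul_eq]
    rw [hcard]
    by_cases hc : ((Finset.univ : Finset (Fin 4 × Fin 4 × Fin 4)).image (fun p => e p.1 + e p.2.1 + e p.2.2)).card ≤ 19
    · exact doorA34_on_of_card_tripleSums_le e hc (S ∘ σ) (fun k => hS _)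
    · obtain ⟨l, hl⟩ := hdef
      have hdef' : ((S ∘ σ) (σ.symm l)).PosDef ∨ (-(S ∘ σ) (σ.symm l)).PosDef := by
        simpa [Function.comp, Equiv.apply_symm_apply] using hl
      exact lp34_box12_sorted e he_mono he0 he3 (by omega) (S ∘ σ) (fun k => hS _) ⟨σ.symm l, hdef'⟩
  · exact doorA34_on_of_not_injective d hinj S hS

end Summit.ValiantsHypothesis.ValiantsHypothesis.Theorems.LacunarySymmetroidMatrixDescartes.Census
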